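import Summits.HubbardSuperconductivity.HubbardSuperconductivity.Theorems.AnisotropyChordTransferCompressibility
import Summits.HubbardSuperconductivity.HubbardSuperconductivity.Theorems.AnisotropyChordStiffnessDoobExchangeability
import Literature.Probability.LatticeModels.TorusFourierProofs

/-!
# Route `AnisotropyChord` / H0 rotor rung, route (1): HYPOTHESIS F of PROPOSITION N — part 1, the LATTICE f-SUM IDENTITY
# (theory seat `hubbard-h0-rotor-theory-1` g12, memo ROTOR-THEORY-12 §184(h) «F routine: double commutator»; critic-4 g9 P5;
# prover seat `hubbard-h0-rotor-p1` g15)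

For the Perron amplitude `a` of a sector of `H(Δ) = xxzHamiltonian 1 (torusGraph 2 L) (−1) Δ` and the first density wave
`c(σ) = Σ_s cos(2π s₀/L) n_s(σ)` (`cosWave`), the f-sum `fsumC = ⟨c a, (H − E) c a⟩ = ½⟨a, [c, [H, c]] a⟩` is a sum over bonds:

* `hopCorr a x y = Σ_σ [σ_x ≠ σ_y] a(σ) a(σ ∘ swap x y)` — the exchange (hopping) correlation `⟨a, (S⁺_x S⁻_y + S⁻_x S⁺_y) a⟩`
  across the ordered pair `(x, y)`; `brkMass a x y = Σ_σ [σ_x ≠ σ_y] a(σ)²`;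
* **`fsumC_eq_bond_sum`** (double commutator): `fsumC L Δ M a = ⅛ Σ_x Σ_y [x ∼ y] (cos(2πx₀/L) − cos(2πy₀/L))² · hopCorr a x y`;
* `inner_fmOp_eq_bond_sum`, `inner_isingW_eq_bond_sum` — the kinetic and Ising energies of a real amplitude as bond sums;
* `hopCorr_map_equiv` + the coordinate swap `axisSwapIso` (a torus automorphism) + translation invariance ⇒
  **`hopCorr_perron_adj`**: a Perron amplitude has the same exchange correlation on every directed bond;
* the trigonometric sum `Σ_x (cos(2πx₀/L) − cos(2π(x₀+1)/L))² = L²(1 − cos(2π/L)) ≥ 8` (`L ≥ 3`, characters of `(ℤ/L)²` +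
  Jordan's inequality), whence **`hopCorr_le_fsumC`**: `hopCorr a 0 e₀ ≤ fsumC L Δ M a` for `L ≥ 3`.

Part 2 (`…TransferFsumBound`) bounds `hopCorr a 0 e₀` from below by the exchangeability trial state and proves HYPOTHESIS F.
All statements are folklore (lattice f-sum rule: Pitaevskii–Stringari 1991 / Stringari 1995 eq. (10); Hohenberg–Brinkman 1974).
-/

set_option linter.dupNamespace false
set_option autoImplicit false

noncomputable section

open Finset Filter Topology
open Literature.MathematicalPhysics.QuantumLattice Literature.Probability.LatticeModels
open Summit.HubbardSuperconductivity.HubbardSuperconductivity.Theorems.AnisotropyChord.InsertionEntropy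
open Summit.HubbardSuperconductivity.HubbardSuperconductivity.Theorems.AnisotropyChord.Tower

namespace Summit.HubbardSuperconductivity.HubbardSuperconductivity.Theorems.AnisotropyChord.Transfer

/-! ## Bond quantities of a real amplitude on a finite graph -/

section General

variable {V : Type} [Fintype V] [DecidableEq V]

/-- broken-bond indicator `[σ_x ≠ σ_y] ∈ {0, 1}`. [folklore] -/
def brk (σ : V → Fin 2) (x y : V) : ℝ := if σ x = σ y then 0 else 1

/-- exchange (hopping) correlation across the ordered pair `(x, y)`:
`Σ_σ [σ_x ≠ σ_y] a(σ) a(σ ∘ swap x y) = ⟨a, (S⁺_x S⁻_y + S⁻_x S⁺_y) a⟩` for a real amplitude `a`. [folklore] -/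
def hopCorr (a : (V → Fin 2) → ℝ) (x y : V) : ℝ := ∑ σ, brk σ x y * (a σ * a (σ ∘ ⇑(Equiv.swap x y)))

/-- broken-bond mass `Σ_σ [σ_x ≠ σ_y] a(σ)²` of a real amplitude. [folklore] -/
def brkMass (a : (V → Fin 2) → ℝ) (x y : V) : ℝ := ∑ σ, brk σ x y * a σ ^ 2

omit [Fintype V] [DecidableEq V] in
/-- `brk` is symmetric in the two sites. [folklore] -/
theorem brk_symm (σ : V → Fin 2) (x y : V) : brk σ y x = brk σ x y := by
  unfold brk; simp only [eq_comm]

omit [Fintype V] [DecidableEq V] in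
/-- `0 ≤ brk`. [folklore] -/
theorem brk_nonneg (σ : V → Fin 2) (x y : V) : 0 ≤ brk σ x y := by
  unfold brk; split_ifs <;> norm_num

omit [Fintype V] [DecidableEq V] in
/-- `brk ≤ 1`. [folklore] -/
theorem brk_le_one (σ : V → Fin 2) (x y : V) : brk σ x y ≤ 1 := by
  unfold brk; split_ifs <;> norm_num

omit [Fintype V] in
/-- `brk` is invariant under the exchange of the two occupations. [folklore] -/
theorem brk_comp_swap (σ : V → Fin 2) (x y : V) : brk (σ ∘ ⇑(Equiv.swap x y)) x y = brk σ x y := by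
  unfold brk
  simp only [Function.comp_apply, Equiv.swap_apply_left, Equiv.swap_apply_right, eq_comm]

omit [Fintype V] [DecidableEq V] in
/-- `(n_x − n_y)² = [σ_x ≠ σ_y]` for `0/1` occupations. [folklore] -/
theorem occ_sub_sq_eq_brk (σ : V → Fin 2) (x y : V) :
    (((σ x : ℕ) : ℝ) - ((σ y : ℕ) : ℝ)) ^ 2 = brk σ x y := by
  unfold brk
  rcases Stiffness.Doob.fin2_eq_zero_or_one (σ x) with hx | hx <;>
    rcases Stiffness.Doob.fin2_eq_zero_or_one (σ y) with hy | hy <;> simp [hx, hy]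

/-- `a(σ)(a(σ) − a(σ ∘ swap x y)) = [σ_x ≠ σ_y](a(σ)² − a(σ) a(σ ∘ swap x y))` (an unbroken bond is fixed by the swap). [folklore] -/
theorem mul_sub_comp_swap_eq (a : (V → Fin 2) → ℝ) (σ : V → Fin 2) (x y : V) :
    a σ * (a σ - a (σ ∘ ⇑(Equiv.swap x y))) = brk σ x y * (a σ ^ 2 - a σ * a (σ ∘ ⇑(Equiv.swap x y))) := by
  unfold brk
  by_cases h : σ x = σ y
  · rw [if_pos h, comp_swap_of_eq σ h]; ring
  · rw [if_neg h]; ring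

/-- `hopCorr` is symmetric in the two sites. [folklore] -/
theorem hopCorr_symm (a : (V → Fin 2) → ℝ) (x y : V) : hopCorr a y x = hopCorr a x y := by
  unfold hopCorr
  refine Finset.sum_congr rfl fun σ _ => ?_
  rw [brk_symm, Equiv.swap_comm]

/-- `hopCorr ≥ 0` for a non-negative amplitude. [folklore] -/
theorem hopCorr_nonneg {a : (V → Fin 2) → ℝ} (ha : ∀ σ, 0 ≤ a σ) (x y : V) : 0 ≤ hopCorr a x y := by
  unfold hopCorr
  exact Finset.sum_nonneg fun σ _ => mul_nonneg (brk_nonneg σ x y) (mul_nonneg (ha σ) (ha _))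

/-- `0 ≤ brkMass`. [folklore] -/
theorem brkMass_nonneg (a : (V → Fin 2) → ℝ) (x y : V) : 0 ≤ brkMass a x y := by
  unfold brkMass
  exact Finset.sum_nonneg fun σ _ => mul_nonneg (brk_nonneg σ x y) (sq_nonneg _)

/-- `brkMass ≤ Σ a²`. [folklore] -/
theorem brkMass_le_sum_sq (a : (V → Fin 2) → ℝ) (x y : V) : brkMass a x y ≤ ∑ σ, a σ ^ 2 := by
  unfold brkMass
  refine Finset.sum_le_sum fun σ _ => ?_
  have h1 := brk_le_one σ x y
  have h2 := sq_nonneg (a σ)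
  nlinarith

/-- **`hopCorr` is covariant under site relabellings that fix the amplitude**: if `a(σ ∘ R) = a(σ)` for all `σ`, then
`hopCorr a (R x) (R y) = hopCorr a x y`. [folklore] -/
theorem hopCorr_map_equiv (a : (V → Fin 2) → ℝ) (R : V ≃ V) (hR : ∀ σ, a (σ ∘ ⇑R) = a σ) (x y : V) :
    hopCorr a (R x) (R y) = hopCorr a x y := by
  unfold hopCorr
  -- reindex the right-hand side by `σ ↦ σ ∘ R`
  have hbij : Function.Bijective (fun σ : V → Fin 2 => σ ∘ ⇑R) := by
    refine ⟨fun σ τ h => ?_, fun τ => ⟨τ ∘ ⇑R.symm, ?_⟩⟩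
    · funext z
      have := congrFun h (R.symm z)
      simpa using this
    · funext z; simp
  rw [← hbij.sum_comp (fun τ => brk τ x y * (a τ * a (τ ∘ ⇑(Equiv.swap x y))))]
  refine Finset.sum_congr rfl fun σ _ => ?_
  have hswap : (σ ∘ ⇑R) ∘ ⇑(Equiv.swap x y) = (σ ∘ ⇑(Equiv.swap (R x) (R y))) ∘ ⇑R := by
    funext z
    simp only [Function.comp_apply, R.injective.map_swap]
  simp only [hR, hswap]
  rfl

variable (G : SimpleGraph V) [DecidableRel G.Adj]

/-- **kinetic energy as a bond sum:** `Σ_σ a(Aa) = ¼ Σ_x Σ_y [x ∼ y] (brkMass a x y − hopCorr a x y)`. [folklore] -/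
theorem inner_fmOp_eq_bond_sum (a : (V → Fin 2) → ℝ) :
    ∑ σ, a σ * fmOp G a σ
      = (1/4 : ℝ) * ∑ x, ∑ y, if G.Adj x y then (brkMass a x y - hopCorr a x y) else 0 := by
  unfold fmOp brkMass hopCorr
  calc ∑ σ, a σ * ((1/4 : ℝ) * ∑ x, ∑ y, if G.Adj x y then (a σ - a (σ ∘ ⇑(Equiv.swap x y))) else 0)
      = (1/4 : ℝ) * ∑ σ, ∑ x, ∑ y,
          (if G.Adj x y then brk σ x y * (a σ ^ 2 - a σ * a (σ ∘ ⇑(Equiv.swap x y))) else 0) := by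
        rw [Finset.mul_sum]
        refine Finset.sum_congr rfl fun σ _ => ?_
        rw [mul_left_comm, Finset.mul_sum]
        congr 1
        refine Finset.sum_congr rfl fun x _ => ?_
        rw [Finset.mul_sum]
        refine Finset.sum_congr rfl fun y _ => ?_
        by_cases h : G.Adj x y
        · rw [if_pos h, if_pos h, mul_sub_comp_swap_eq]
        · rw [if_neg h, if_neg h, mul_zero]
    _ = (1/4 : ℝ) * ∑ x, ∑ y, ∑ σ,
          (if G.Adj x y then brk σ x y * (a σ ^ 2 - a σ * a (σ ∘ ⇑(Equiv.swap x y))) else 0) := by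
        congr 1
        rw [Finset.sum_comm]
        exact Finset.sum_congr rfl fun x _ => Finset.sum_comm
    _ = (1/4 : ℝ) * ∑ x, ∑ y, if G.Adj x y then
          ((∑ σ, brk σ x y * a σ ^ 2) - ∑ σ, brk σ x y * (a σ * a (σ ∘ ⇑(Equiv.swap x y)))) else 0 := by
        congr 1
        refine Finset.sum_congr rfl fun x _ => Finset.sum_congr rfl fun y _ => ?_
        by_cases h : G.Adj x y
        · simp only [if_pos h]
          rw [← Finset.sum_sub_distrib]
          refine Finset.sum_congr rfl fun σ _ => by ring
        · simp only [if_neg h, Finset.sum_const_zero]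

/-- **Ising energy as a bond sum:** `Σ_σ W(σ) a(σ)² = (D/8) Σ a² − ¼ Σ_x Σ_y [x ∼ y] brkMass a x y`. [folklore] -/
theorem inner_isingW_eq_bond_sum (a : (V → Fin 2) → ℝ) :
    ∑ σ, isingW G σ * a σ ^ 2
      = (1/8 : ℝ) * (∑ x, ∑ y, if G.Adj x y then (1:ℝ) else 0) * ∑ σ, a σ ^ 2
        - (1/4 : ℝ) * ∑ x, ∑ y, if G.Adj x y then brkMass a x y else 0 := by
  unfold isingW brkMass
  -- pointwise: the Ising factor is `¼ − ½ brk`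
  have hpt : ∀ (σ : V → Fin 2) (x y : V),
      (if σ x = σ y then (1/4 : ℝ) else -(1/4 : ℝ)) = (1/4 : ℝ) - (1/2 : ℝ) * brk σ x y := by
    intro σ x y; unfold brk; split_ifs <;> norm_num
  calc ∑ σ, (1/2 : ℝ) * (∑ x, ∑ y, if G.Adj x y then (if σ x = σ y then (1/4 : ℝ) else -(1/4 : ℝ)) else 0) * a σ ^ 2
      = ∑ σ, ∑ x, ∑ y, (if G.Adj x y then ((1/8 : ℝ) * a σ ^ 2 - (1/4 : ℝ) * (brk σ x y * a σ ^ 2)) else 0) := by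
        refine Finset.sum_congr rfl fun σ _ => ?_
        rw [mul_comm, ← mul_assoc, Finset.mul_sum]
        refine Finset.sum_congr rfl fun x _ => ?_
        rw [Finset.mul_sum]
        refine Finset.sum_congr rfl fun y _ => ?_
        by_cases h : G.Adj x y
        · rw [if_pos h, if_pos h, hpt]; ring
        · rw [if_neg h, if_neg h, mul_zero]
    _ = ∑ x, ∑ y, ∑ σ, (if G.Adj x y then ((1/8 : ℝ) * a σ ^ 2 - (1/4 : ℝ) * (brk σ x y * a σ ^ 2)) else 0) := by
        rw [Finset.sum_comm]
        exact Finset.sum_congr rfl fun x _ => Finset.sum_comm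
    _ = ∑ x, ∑ y, ((if G.Adj x y then (1:ℝ) else 0) * ((1/8 : ℝ) * ∑ σ, a σ ^ 2)
          - (1/4 : ℝ) * (if G.Adj x y then ∑ σ, brk σ x y * a σ ^ 2 else 0)) := by
        refine Finset.sum_congr rfl fun x _ => Finset.sum_congr rfl fun y _ => ?_
        by_cases h : G.Adj x y
        · simp only [if_pos h, one_mul]
          rw [Finset.sum_sub_distrib, ← Finset.mul_sum, ← Finset.mul_sum]
        · simp only [if_neg h, Finset.sum_const_zero, zero_mul, mul_zero, sub_zero]
    _ = (∑ x, ∑ y, (if G.Adj x y then (1:ℝ) else 0) * ((1/8 : ℝ) * ∑ σ, a σ ^ 2))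
        - ∑ x, ∑ y, (1/4 : ℝ) * (if G.Adj x y then ∑ σ, brk σ x y * a σ ^ 2 else 0) := by
        rw [← Finset.sum_sub_distrib]
        refine Finset.sum_congr rfl fun x _ => ?_
        rw [← Finset.sum_sub_distrib]
    _ = (1/8 : ℝ) * (∑ x, ∑ y, if G.Adj x y then (1:ℝ) else 0) * ∑ σ, a σ ^ 2
        - (1/4 : ℝ) * ∑ x, ∑ y, if G.Adj x y then (∑ σ, brk σ x y * a σ ^ 2) else 0 := by
        have e1 : (∑ x, ∑ y, (if G.Adj x y then (1:ℝ) else 0) * ((1/8 : ℝ) * ∑ σ, a σ ^ 2))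
            = (1/8 : ℝ) * (∑ x, ∑ y, if G.Adj x y then (1:ℝ) else 0) * ∑ σ, a σ ^ 2 := by
          symm
          calc (1/8 : ℝ) * (∑ x, ∑ y, if G.Adj x y then (1:ℝ) else 0) * ∑ σ, a σ ^ 2
              = (∑ x, ∑ y, if G.Adj x y then (1:ℝ) else 0) * ((1/8 : ℝ) * ∑ σ, a σ ^ 2) := by ring
            _ = ∑ x, ∑ y, (if G.Adj x y then (1:ℝ) else 0) * ((1/8 : ℝ) * ∑ σ, a σ ^ 2) := by
                rw [Finset.sum_mul]
                refine Finset.sum_congr rfl fun x _ => ?_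
                rw [Finset.sum_mul]
        have e2 : ∑ x, ∑ y, (1/4 : ℝ) * (if G.Adj x y then ∑ σ, brk σ x y * a σ ^ 2 else 0)
            = (1/4 : ℝ) * ∑ x, ∑ y, if G.Adj x y then (∑ σ, brk σ x y * a σ ^ 2) else 0 := by
          rw [Finset.mul_sum]
          refine Finset.sum_congr rfl fun x _ => ?_
          rw [Finset.mul_sum]
        rw [e1, e2]

end General

/-! ## The torus: the first density wave under a hop, and the f-sum identity -/

section Torus

variable {L : ℕ} [NeZero L]

/-- the site cosine `cos(2π s₀/L)` of the first density wave. [folklore] -/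
def siteCos (L : ℕ) (s : TorusSite 2 L) : ℝ := Real.cos (2 * Real.pi * ((s 0).val : ℝ) / (L : ℝ))

/-- `cosWave σ = Σ_s siteCos s · n_s(σ)` (definitional). [folklore] -/
theorem cosWave_eq (σ : TensorIndex (TorusSite 2 L) 2) : cosWave L σ = ∑ s, siteCos L s * occNum L σ s := rfl

/-- **a hop across `(x, y)` changes the density wave by `(c_x − c_y)(n_x − n_y)`.** [folklore] -/
theorem cosWave_sub_comp_swap (σ : TensorIndex (TorusSite 2 L) 2) (x y : TorusSite 2 L) :
    cosWave L σ - cosWave L (σ ∘ ⇑(Equiv.swap x y))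
      = (siteCos L x - siteCos L y) * (occNum L σ x - occNum L σ y) := by
  rw [cosWave_eq, cosWave_eq]
  -- reindex the swapped wave
  have hre : ∑ s, siteCos L s * occNum L (σ ∘ ⇑(Equiv.swap x y)) s
      = ∑ s, siteCos L (Equiv.swap x y s) * occNum L σ s := by
    rw [← Equiv.sum_comp (Equiv.swap x y) (fun s => siteCos L (Equiv.swap x y s) * occNum L σ s)]
    refine Finset.sum_congr rfl fun s _ => ?_
    simp only [occNum, Function.comp_apply, Equiv.swap_apply_self]
  rw [hre, ← Finset.sum_sub_distrib]
  have hterm : ∀ s, siteCos L s * occNum L σ s - siteCos L (Equiv.swap x y s) * occNum L σ s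
      = (siteCos L s - siteCos L (Equiv.swap x y s)) * occNum L σ s := fun s => by ring
  simp only [hterm]
  by_cases hxy : x = y
  · subst hxy
    simp [Equiv.swap_self]
  · rw [Fintype.sum_eq_add x y hxy]
    · rw [Equiv.swap_apply_left, Equiv.swap_apply_right]; ring
    · intro s hs
      rw [Equiv.swap_apply_of_ne_of_ne hs.1 hs.2, sub_self, zero_mul]

/-- squared form: `(c(σ) − c(σ ∘ swap x y))² = (c_x − c_y)² [σ_x ≠ σ_y]`. [folklore] -/
theorem cosWave_sub_comp_swap_sq (σ : TensorIndex (TorusSite 2 L) 2) (x y : TorusSite 2 L) :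
    (cosWave L σ - cosWave L (σ ∘ ⇑(Equiv.swap x y))) ^ 2 = (siteCos L x - siteCos L y) ^ 2 * brk σ x y := by
  rw [cosWave_sub_comp_swap, mul_pow, ← occ_sub_sq_eq_brk]
  rfl

/-- the symmetrised bond term: `Σ_σ c(σ) a(σ) a(σ') (c(σ) − c(σ')) = ½ (c_x − c_y)² hopCorr a x y`, `σ' = σ ∘ swap x y`. [folklore] -/
theorem sum_cos_hop_eq (a : TensorIndex (TorusSite 2 L) 2 → ℝ) (x y : TorusSite 2 L) :
    ∑ σ, cosWave L σ * a σ * a (σ ∘ ⇑(Equiv.swap x y)) * (cosWave L σ - cosWave L (σ ∘ ⇑(Equiv.swap x y)))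
      = (1/2 : ℝ) * ((siteCos L x - siteCos L y) ^ 2 * hopCorr a x y) := by
  set f : TensorIndex (TorusSite 2 L) 2 → ℝ := fun σ =>
    cosWave L σ * a σ * a (σ ∘ ⇑(Equiv.swap x y)) * (cosWave L σ - cosWave L (σ ∘ ⇑(Equiv.swap x y))) with hf
  -- the involution `σ ↦ σ ∘ swap x y`
  have hinv : ∀ σ : TensorIndex (TorusSite 2 L) 2, (σ ∘ ⇑(Equiv.swap x y)) ∘ ⇑(Equiv.swap x y) = σ := by
    intro σ; funext z; simp [Equiv.swap_apply_self]
  have hbij : Function.Bijective (fun σ : TensorIndex (TorusSite 2 L) 2 => σ ∘ ⇑(Equiv.swap x y)) :=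
    ⟨fun σ τ h => by simpa [hinv] using congrArg (fun ν => ν ∘ ⇑(Equiv.swap x y)) h, fun τ => ⟨_, hinv τ⟩⟩
  have hsum : ∑ σ, f σ = ∑ σ, f (σ ∘ ⇑(Equiv.swap x y)) := (hbij.sum_comp f).symm
  have h2 : 2 * ∑ σ, f σ = ∑ σ, (f σ + f (σ ∘ ⇑(Equiv.swap x y))) := by
    rw [two_mul, Finset.sum_add_distrib, ← hsum]
  have h3 : ∑ σ, (f σ + f (σ ∘ ⇑(Equiv.swap x y)))
      = ∑ σ, a σ * a (σ ∘ ⇑(Equiv.swap x y)) * (cosWave L σ - cosWave L (σ ∘ ⇑(Equiv.swap x y))) ^ 2 := by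
    refine Finset.sum_congr rfl fun σ _ => ?_
    simp only [hf, hinv]; ring
  have h4 : ∑ σ, a σ * a (σ ∘ ⇑(Equiv.swap x y)) * (cosWave L σ - cosWave L (σ ∘ ⇑(Equiv.swap x y))) ^ 2
      = (siteCos L x - siteCos L y) ^ 2 * hopCorr a x y := by
    unfold hopCorr
    rw [Finset.mul_sum]
    refine Finset.sum_congr rfl fun σ _ => ?_
    rw [cosWave_sub_comp_swap_sq]; ring
  show ∑ σ, f σ = _
  linarith [h2, h3, h4]

/-- `sectorE` is the `lowestEnergyInSector` of the tree Hamiltonian (definitional). [folklore] -/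
theorem sectorE_eq (Δ M : ℝ) :
    sectorE L Δ M = lowestEnergyInSector 1 (xxzHamiltonian 1 (torusGraph 2 L) (-1) Δ) M := rfl

/-- **THE LATTICE f-SUM IDENTITY (double commutator):** for a Perron sector amplitude `a`,
`⟨c a, (H − E(M)) c a⟩ = ⅛ Σ_x Σ_y [x ∼ y] (c_x − c_y)² · hopCorr a x y`.
[folklore: Pitaevskii–Stringari 1991; Hohenberg–Brinkman 1974 (lattice first-moment sum rule)] -/
theorem fsumC_eq_bond_sum {Δ M : ℝ} {a : TensorIndex (TorusSite 2 L) 2 → ℝ}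
    (ha : IsPerronSectorGroundAmplitude L Δ M a) :
    fsumC L Δ M a = (1/8 : ℝ) * ∑ x : TorusSite 2 L, ∑ y,
      if (torusGraph 2 L).Adj x y then (siteCos L x - siteCos L y) ^ 2 * hopCorr a x y else 0 := by
  -- the facts we need, stated before abbreviating (so that `set` folds them too)
  have eQ := energyQ_eq_real (L := L) Δ (feynmanVec L a)
  have hpe : ∀ σ, fmOp (torusGraph 2 L) a σ + (1 - Δ) * (isingW (torusGraph 2 L) σ * a σ)
      = (sectorE L Δ M + (1/8 : ℝ) * ∑ x : TorusSite 2 L, ∑ y, if (torusGraph 2 L).Adj x y then (1:ℝ) else 0) * a σ :=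
    fun σ => by rw [sectorE_eq]; exact perron_eigen_real ha σ
  have hfv : ∀ σ, feynmanVec L a σ = cosWave L σ * a σ := fun σ => rfl
  unfold fsumC strucC
  set G := torusGraph 2 L with hG
  set D : ℝ := ∑ x : TorusSite 2 L, ∑ y, if G.Adj x y then (1:ℝ) else 0 with hD
  set E : ℝ := sectorE L Δ M with hE
  set c : TensorIndex (TorusSite 2 L) 2 → ℝ := cosWave L with hc
  -- the eigen-equation, multiplied by `c(σ)² a(σ)`
  have heig : ∀ σ, (E + (1/8 : ℝ) * D) * (c σ * a σ) ^ 2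
      = (c σ * a σ) * (c σ * fmOp G a σ) + (1 - Δ) * (isingW G σ * (c σ * a σ) ^ 2) := by
    intro σ
    calc (E + (1/8 : ℝ) * D) * (c σ * a σ) ^ 2
        = c σ ^ 2 * a σ * ((E + (1/8 : ℝ) * D) * a σ) := by ring
      _ = c σ ^ 2 * a σ * (fmOp G a σ + (1 - Δ) * (isingW G σ * a σ)) := by rw [hpe σ]
      _ = _ := by ring
  -- fsumC in pointwise form
  have h1 : energyQ L Δ (feynmanVec L a) - E * ∑ σ, feynmanVec L a σ ^ 2
      = ∑ σ, c σ * a σ * (fmOp G (feynmanVec L a) σ - c σ * fmOp G a σ) := by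
    have step : energyQ L Δ (feynmanVec L a) - E * ∑ σ, feynmanVec L a σ ^ 2
        = ∑ σ, (feynmanVec L a σ * (fmOp G (feynmanVec L a) σ + (1 - Δ) * (isingW G σ * feynmanVec L a σ))
            - (1/8 : ℝ) * D * feynmanVec L a σ ^ 2 - E * feynmanVec L a σ ^ 2) := by
      rw [Finset.sum_sub_distrib, Finset.sum_sub_distrib, ← Finset.mul_sum, ← Finset.mul_sum, ← eQ]
    rw [step]
    refine Finset.sum_congr rfl fun σ _ => ?_
    have := heig σ
    rw [hfv σ]
    linear_combination -this
  -- the commutator `A(c a) − c A a` pointwise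
  have h2 : ∀ σ, fmOp G (feynmanVec L a) σ - c σ * fmOp G a σ
      = (1/4 : ℝ) * ∑ x, ∑ y, if G.Adj x y then
          a (σ ∘ ⇑(Equiv.swap x y)) * (c σ - c (σ ∘ ⇑(Equiv.swap x y))) else 0 := by
    intro σ
    unfold fmOp
    simp only [hfv]
    rw [mul_left_comm, ← mul_sub, Finset.mul_sum, ← Finset.sum_sub_distrib]
    congr 1
    refine Finset.sum_congr rfl fun x _ => ?_
    rw [Finset.mul_sum, ← Finset.sum_sub_distrib]
    refine Finset.sum_congr rfl fun y _ => ?_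
    by_cases h : G.Adj x y
    · rw [if_pos h, if_pos h, if_pos h]; ring
    · rw [if_neg h, if_neg h, if_neg h]; ring
  rw [h1]
  calc ∑ σ, c σ * a σ * (fmOp G (feynmanVec L a) σ - c σ * fmOp G a σ)
      = ∑ σ, (1/4 : ℝ) * ∑ x, ∑ y, if G.Adj x y then
          c σ * a σ * a (σ ∘ ⇑(Equiv.swap x y)) * (c σ - c (σ ∘ ⇑(Equiv.swap x y))) else 0 := by
        refine Finset.sum_congr rfl fun σ _ => ?_
        rw [h2 σ, mul_left_comm, Finset.mul_sum]
        congr 1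
        refine Finset.sum_congr rfl fun x _ => ?_
        rw [Finset.mul_sum]
        refine Finset.sum_congr rfl fun y _ => ?_
        by_cases h : G.Adj x y
        · rw [if_pos h, if_pos h]; ring
        · rw [if_neg h, if_neg h, mul_zero]
    _ = (1/4 : ℝ) * ∑ x, ∑ y, ∑ σ, if G.Adj x y then
          c σ * a σ * a (σ ∘ ⇑(Equiv.swap x y)) * (c σ - c (σ ∘ ⇑(Equiv.swap x y))) else 0 := by
        rw [← Finset.mul_sum]
        congr 1
        rw [Finset.sum_comm]
        exact Finset.sum_congr rfl fun x _ => Finset.sum_comm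
    _ = (1/4 : ℝ) * ∑ x, ∑ y, if G.Adj x y then
          (1/2 : ℝ) * ((siteCos L x - siteCos L y) ^ 2 * hopCorr a x y) else 0 := by
        congr 1
        refine Finset.sum_congr rfl fun x _ => Finset.sum_congr rfl fun y _ => ?_
        by_cases h : G.Adj x y
        · simp only [if_pos h]
          rw [hc]; exact sum_cos_hop_eq a x y
        · simp only [if_neg h, Finset.sum_const_zero]
    _ = (1/8 : ℝ) * ∑ x, ∑ y, if G.Adj x y then (siteCos L x - siteCos L y) ^ 2 * hopCorr a x y else 0 := by
        rw [show (1/8 : ℝ) = (1/4 : ℝ) * (1/2 : ℝ) by norm_num, mul_assoc]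
        congr 1
        symm
        rw [Finset.mul_sum]
        refine Finset.sum_congr rfl fun x _ => ?_
        rw [Finset.mul_sum]
        refine Finset.sum_congr rfl fun y _ => ?_
        by_cases h : G.Adj x y
        · rw [if_pos h, if_pos h]
        · rw [if_neg h, if_neg h, mul_zero]

end Torus

end Summit.HubbardSuperconductivity.HubbardSuperconductivity.Theorems.AnisotropyChord.Transfer
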